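import Mathlib.Algebra.Polynomial.OfFn
import Mathlib.Algebra.Polynomial.AlgebraMap
import Mathlib.Analysis.SpecialFunctions.Log.Basic
import Mathlib.Analysis.Complex.Basic
import Mathlib.Data.Nat.Sqrt
import Mathlib.Data.Int.Interval
import Mathlib.Data.Fintype.BigOperators
import HarnessLib

/-!
# Small values of integer polynomials at a complex point (Bugeaud 2004, Lemma 8.1)

Y. Bugeaud, *Approximation by Algebraic Numbers* (Cambridge Tracts 160, 2004), §8.2,
**Lemma 8.1** (PDF p. 177), in its explicit form for `n ≥ 50`: for `ξ ∈ ℂ`, an integer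
`n ≥ 50` and a real `H ≥ (4 + |ξ|)^{50}` there is a non-zero integer polynomial `P` with
`deg P ≤ n`, `H(P) ≤ H` and `|P(ξ)| ≤ H^{-0.455 n}`. Proof by Dirichlet's box principle as
printed: the `(2K+1)^{n+1}` values `a_n ξⁿ + … + a₀` (`|aᵢ| ≤ K = ⌊H/2⌋`) lie in a square of
side `2(K c₄ + 1)`, `c₄ = ∑_{i ≤ n} |ξ|ⁱ`, cut into `N²` cells with `N² < (2K+1)^{n+1} ≤ (N+1)²`;
two values in one cell differ by a polynomial of height `≤ 2K ≤ H` with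
`|P(ξ)|² ≤ 64 c₄² (2K+1)^{1-n} ≤ 2^{n+5} (4+|ξ|)^{2n} H^{1-n} ≤ H^{-0.91 n}` for `n ≥ 27`
(the printed constants `c₂ = (4+|ξ|)^{50}`, `c₃ = 0.455` have ample room; our grid differs from
Bugeaud's `H'`-trick only in bookkeeping).

## Contents
* `sum_pow_le_one_add_pow` — `∑_{i ≤ n} xⁱ ≤ (1 + x)ⁿ`.
* `exists_int_poly_small_value` — Lemma 8.1 with `c₂ = (4 + |ξ|)^{50}`, `c₃ = 0.455`, the bound
  written `‖P(ξ)‖ ≤ exp(-0.455 · n · log H)`.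
-/

namespace Literature.NumberTheory.DiophantineApproximation

open Polynomial Finset

/-- `∑_{i=0}^{n} xⁱ ≤ (1 + x)ⁿ` for `x ≥ 0`. [folklore] -/
theorem sum_pow_le_one_add_pow (x : ℝ) (hx : 0 ≤ x) (n : ℕ) :
    ∑ i ∈ Finset.range (n + 1), x ^ i ≤ (1 + x) ^ n := by
  induction n with
  | zero => simp
  | succ k ih =>
    rw [Finset.sum_range_succ]
    have h1 : x ^ (k + 1) ≤ x * (1 + x) ^ k := by
      rw [pow_succ']
      gcongr
      linarith
    calc ∑ i ∈ Finset.range (k + 1), x ^ i + x ^ (k + 1) ≤ (1 + x) ^ k + x * (1 + x) ^ k := by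
          gcongr
      _ = (1 + x) ^ (k + 1) := by ring

/-- Two reals with the same cell index in a grid of mesh `w` are `< w` apart. [folklore] -/
theorem abs_sub_lt_of_floor_eq {x y s w : ℝ} (hw : 0 < w) (hx : 0 ≤ (x + s) / w)
    (hy : 0 ≤ (y + s) / w) (h : ⌊(x + s) / w⌋₊ = ⌊(y + s) / w⌋₊) : |x - y| < w := by
  have h1 := (Nat.floor_eq_iff hx).1 rfl
  have h2 := (Nat.floor_eq_iff hy).1 h.symm
  have : |(x + s) / w - (y + s) / w| < 1 := by
    rw [abs_lt]; constructor <;> linarith [h1.1, h1.2, h2.1, h2.2]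
  rw [← sub_div, abs_div, abs_of_pos hw, div_lt_one hw] at this
  simpa using this

/-- **Bugeaud 2004, Lemma 8.1** (explicit form, `n ≥ 50`, `c₂ = (4 + |ξ|)^{50}`, `c₃ = 0.455`):
there is a non-zero integer polynomial `P` of degree `≤ n` and height `≤ H` with
`|P(ξ)| ≤ H^{-0.455 n}`. [cite: Bugeaud2004, Lemma 8.1] -/
theorem exists_int_poly_small_value (ξ : ℂ) (n : ℕ) (hn : 50 ≤ n) (H : ℝ)
    (hH : (4 + ‖ξ‖) ^ 50 ≤ H) :
    ∃ P : ℤ[X], P ≠ 0 ∧ P.natDegree ≤ n ∧ (∀ i, (|P.coeff i| : ℝ) ≤ H) ∧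
      ‖aeval ξ P‖ ≤ Real.exp (-(455 / 1000) * n * Real.log H) := by
  -- sizes
  set A : ℝ := 4 + ‖ξ‖ with hA
  have hA4 : 4 ≤ A := by rw [hA]; linarith [norm_nonneg ξ]
  have hA0 : 0 < A := by linarith
  have h450 : (4 : ℝ) ^ 50 ≤ H := le_trans (pow_le_pow_left₀ (by norm_num) hA4 50) hH
  have hH2 : (2 : ℝ) ≤ H := le_trans (by norm_num) h450
  have hH0 : 0 < H := by linarith
  set L : ℝ := Real.log H with hL
  have hL2 : 100 * Real.log 2 ≤ L := by
    have h := Real.log_le_log (by positivity) (le_trans (by norm_num) h450 : (2 : ℝ) ^ 100 ≤ H)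
    rw [Real.log_pow] at h
    push_cast at h
    rw [hL]; linarith
  have hlog2 : 0 < Real.log 2 := Real.log_pos one_lt_two
  have hL0 : 0 < L := by linarith
  have hLA : 50 * Real.log A ≤ L := by
    have h := Real.log_le_log (by positivity) hH
    rw [Real.log_pow] at h
    push_cast at h
    rw [hL]; linarith
  -- the box of coefficient vectors
  set K : ℕ := ⌊H / 2⌋₊ with hK
  have hKle : (K : ℝ) ≤ H / 2 := Nat.floor_le (by positivity)
  have hKlt : H / 2 < K + 1 := Nat.lt_floor_add_one _
  have hK1 : 1 ≤ K := Nat.le_floor (by norm_num; linarith)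
  have h2K1 : H / 2 ≤ 2 * K + 1 := by linarith
  set Box : Finset (Fin (n + 1) → ℤ) := Fintype.piFinset fun _ => Finset.Icc (-(K : ℤ)) K with hBox
  have hBoxcard : Box.card = (2 * K + 1) ^ (n + 1) := by
    rw [hBox, Fintype.card_piFinset, Finset.prod_const, Finset.card_univ, Fintype.card_fin,
      Int.card_Icc]
    congr 1
    omega
  have hmemBox : ∀ c ∈ Box, ∀ i, |c i| ≤ (K : ℤ) := by
    intro c hc i
    have := (Fintype.mem_piFinset.1 hc) i
    rw [Finset.mem_Icc] at this
    exact abs_le.2 this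
  -- the values `a_n ξⁿ + … + a₀`
  set v : (Fin (n + 1) → ℤ) → ℂ := fun c => ∑ i, (c i : ℂ) * ξ ^ (i : ℕ) with hv
  set c₄ : ℝ := ∑ i : Fin (n + 1), ‖ξ‖ ^ (i : ℕ) with hc₄
  have hc₄1 : 1 ≤ c₄ := by
    rw [hc₄]
    have : (1 : ℝ) = ‖ξ‖ ^ ((0 : Fin (n + 1)) : ℕ) := by simp
    rw [this]
    exact Finset.single_le_sum (f := fun i : Fin (n + 1) => ‖ξ‖ ^ (i : ℕ))
      (fun i _ => by positivity) (Finset.mem_univ _)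
  have hc₄A : c₄ ≤ A ^ n := by
    calc c₄ = ∑ i ∈ Finset.range (n + 1), ‖ξ‖ ^ i := by
          rw [hc₄, Fin.sum_univ_eq_sum_range (fun i => ‖ξ‖ ^ i)]
      _ ≤ (1 + ‖ξ‖) ^ n := sum_pow_le_one_add_pow ‖ξ‖ (norm_nonneg _) n
      _ ≤ A ^ n := pow_le_pow_left₀ (by positivity) (by rw [hA]; linarith) n
  have hvle : ∀ c ∈ Box, ‖v c‖ ≤ K * c₄ := by
    intro c hc
    calc ‖v c‖ ≤ ∑ i, ‖(c i : ℂ) * ξ ^ (i : ℕ)‖ := norm_sum_le _ _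
      _ ≤ ∑ i : Fin (n + 1), (K : ℝ) * ‖ξ‖ ^ (i : ℕ) := by
          refine Finset.sum_le_sum fun i _ => ?_
          rw [norm_mul, norm_pow, Complex.norm_intCast]
          gcongr
          exact_mod_cast hmemBox c hc i
      _ = K * c₄ := by rw [hc₄, Finset.mul_sum]
  set S' : ℝ := K * c₄ + 1 with hS'
  have hS'0 : 0 < S' := by positivity
  -- the grid
  set B : ℕ := (2 * K + 1) ^ (n + 1) with hB
  have hB2 : 2 ≤ B := by
    calc 2 ≤ 2 * K + 1 := by omega
      _ = (2 * K + 1) ^ 1 := (pow_one _).symm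
      _ ≤ (2 * K + 1) ^ (n + 1) := Nat.pow_le_pow_right (by omega) (by omega)
  set N : ℕ := Nat.sqrt (B - 1) with hN
  have hN2le : N ^ 2 ≤ B - 1 := Nat.sqrt_le' _
  have hBN : B ≤ (N + 1) ^ 2 := by
    have h : B - 1 < (N + 1) ^ 2 := Nat.lt_succ_sqrt' (B - 1)
    omega
  have hN1 : 1 ≤ N := Nat.succ_le_of_lt (Nat.sqrt_pos.2 (by omega))
  have hN0 : (0 : ℝ) < N := by exact_mod_cast hN1
  have hB4N : (B : ℝ) ≤ 4 * (N : ℝ) ^ 2 := by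
    have : B ≤ 4 * N ^ 2 := hBN.trans (by nlinarith)
    exact_mod_cast this
  -- the cell map
  set w : ℝ := 2 * S' / N with hw
  have hw0 : 0 < w := by positivity
  set cell : (Fin (n + 1) → ℤ) → ℕ × ℕ :=
    fun c => (⌊((v c).re + S') / w⌋₊, ⌊((v c).im + S') / w⌋₊) with hcell
  have hre : ∀ c ∈ Box, |(v c).re| ≤ K * c₄ := fun c hc =>
    (Complex.abs_re_le_norm _).trans (hvle c hc)
  have him : ∀ c ∈ Box, |(v c).im| ≤ K * c₄ := fun c hc =>
    (Complex.abs_im_le_norm _).trans (hvle c hc)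
  have hcoord : ∀ x : ℝ, |x| ≤ K * c₄ → 0 ≤ (x + S') / w ∧ ⌊(x + S') / w⌋₊ < N := by
    intro x hx
    have hx' := abs_le.1 hx
    have h0 : 0 ≤ (x + S') / w := div_nonneg (by rw [hS']; linarith) hw0.le
    refine ⟨h0, (Nat.floor_lt h0).2 ?_⟩
    rw [div_lt_iff₀ hw0, hw, mul_div_cancel₀ _ hN0.ne']
    rw [hS']; linarith
  have hmaps : ∀ c ∈ Box, cell c ∈ Finset.range N ×ˢ Finset.range N := by
    intro c hc
    simp only [hcell, Finset.mem_product, Finset.mem_range]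
    exact ⟨(hcoord _ (hre c hc)).2, (hcoord _ (him c hc)).2⟩
  have hcardlt : (Finset.range N ×ˢ Finset.range N).card < Box.card := by
    rw [Finset.card_product, Finset.card_range, hBoxcard, ← pow_two]
    omega
  -- Dirichlet's box principle
  obtain ⟨c, hc, c', hc', hne, heq⟩ :=
    Finset.exists_ne_map_eq_of_card_lt_of_maps_to hcardlt hmaps
  simp only [hcell, Prod.mk.injEq] at heq
  have hdre : |(v c).re - (v c').re| < w :=
    abs_sub_lt_of_floor_eq hw0 (hcoord _ (hre c hc)).1 (hcoord _ (hre c' hc')).1 heq.1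
  have hdim : |(v c).im - (v c').im| < w :=
    abs_sub_lt_of_floor_eq hw0 (hcoord _ (him c hc)).1 (hcoord _ (him c' hc')).1 heq.2
  have hdiff : ‖v c - v c'‖ ≤ 2 * w := by
    calc ‖v c - v c'‖ ≤ |(v c - v c').re| + |(v c - v c').im| := Complex.norm_le_abs_re_add_abs_im _
      _ ≤ w + w := by
          rw [Complex.sub_re, Complex.sub_im]
          exact add_le_add hdre.le hdim.le
      _ = 2 * w := by ring
  -- the polynomial
  refine ⟨ofFn (n + 1) (c - c'), ?_, ?_, ?_, ?_⟩
  · intro h0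
    exact hne (sub_eq_zero.1 (injective_ofFn (n + 1) (by rw [h0, map_zero])))
  · exact Nat.lt_succ_iff.1 (ofFn_natDegree_lt (by omega) _)
  · intro i
    by_cases hi : i < n + 1
    · rw [ofFn_coeff_eq_val_of_lt _ hi, Pi.sub_apply]
      have h1 := hmemBox c hc ⟨i, hi⟩
      have h2 := hmemBox c' hc' ⟨i, hi⟩
      have : |c ⟨i, hi⟩ - c' ⟨i, hi⟩| ≤ (K : ℤ) + K := (abs_sub _ _).trans (add_le_add h1 h2)
      have : (|c ⟨i, hi⟩ - c' ⟨i, hi⟩| : ℝ) ≤ (K : ℝ) + K := by exact_mod_cast this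
      push_cast at this ⊢
      linarith
    · rw [ofFn_coeff_eq_zero_of_ge _ (not_lt.1 hi)]
      simp only [abs_zero, Int.cast_zero]
      exact hH0.le
  · -- the estimate
    have haeval : aeval ξ (ofFn (n + 1) (c - c')) = v c - v c' := by
      rw [ofFn_eq_sum_monomial, map_sum, hv]
      simp only [aeval_monomial, algebraMap_int_eq, eq_intCast, Pi.sub_apply, Int.cast_sub,
        ← Finset.sum_sub_distrib]
      exact Finset.sum_congr rfl fun i _ => by ring
    rw [haeval]
    -- `‖v c - v c'‖² ≤ 64 c₄² / (2K+1)^{n-1} ≤ 2^{n+5} A^{2n} / H^{n-1}`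
    have hsq : ‖v c - v c'‖ ^ 2 ≤ 2 ^ (n + 5) * (A ^ n) ^ 2 / H ^ (n - 1) := by
      have hKR : (1 : ℝ) ≤ K := by exact_mod_cast hK1
      have h2K1pos : (0 : ℝ) < 2 * K + 1 := by positivity
      have hS'le : S' ≤ (2 * K + 1) * c₄ := by rw [hS']; nlinarith
      have hBR : (B : ℝ) = (2 * K + 1) ^ 2 * (2 * (K : ℝ) + 1) ^ (n - 1) := by
        rw [hB, ← pow_add]
        push_cast
        congr 1
        omega
      calc ‖v c - v c'‖ ^ 2 ≤ (2 * w) ^ 2 := pow_le_pow_left₀ (norm_nonneg _) hdiff 2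
        _ = 16 * S' ^ 2 / (N : ℝ) ^ 2 := by rw [hw]; field_simp; ring
        _ ≤ 16 * S' ^ 2 / ((B : ℝ) / 4) := by
            gcongr
            linarith
        _ = 64 * S' ^ 2 / B := by field_simp; ring
        _ ≤ 64 * ((2 * K + 1) * c₄) ^ 2 / B := by gcongr
        _ = 64 * c₄ ^ 2 / (2 * (K : ℝ) + 1) ^ (n - 1) := by
            rw [hBR]; field_simp
        _ ≤ 64 * (A ^ n) ^ 2 / (H / 2) ^ (n - 1) := by
            gcongr
        _ = 2 ^ (n + 5) * (A ^ n) ^ 2 / H ^ (n - 1) := by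
            rw [div_pow, show (2 : ℝ) ^ (n + 5) = 64 * 2 ^ (n - 1) by
              rw [show n + 5 = (n - 1) + 6 by omega, pow_add]; norm_num; ring]
            field_simp
    -- pass to exponentials
    have hexpH : H ^ (n - 1) = Real.exp ((n - 1 : ℕ) * L) := by
      rw [Real.exp_nat_mul, hL, Real.exp_log hH0]
    have hexpA : (A ^ n) ^ 2 ≤ Real.exp (2 * n * (L / 50)) := by
      rw [← pow_mul, ← Real.exp_log (pow_pos hA0 _), Real.log_pow]
      apply Real.exp_le_exp.2
      have h : Real.log A ≤ L / 50 := by linarith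
      rw [show ((n * 2 : ℕ) : ℝ) = 2 * n by push_cast; ring]
      exact mul_le_mul_of_nonneg_left h (by positivity)
    have hexp2 : (2 : ℝ) ^ (n + 5) ≤ Real.exp ((n + 5 : ℕ) * (L / 100)) := by
      rw [← Real.exp_log (by positivity : (0 : ℝ) < 2 ^ (n + 5)), Real.log_pow]
      apply Real.exp_le_exp.2
      have h : Real.log 2 ≤ L / 100 := by linarith
      exact mul_le_mul_of_nonneg_left h (by positivity)
    have hsq' : ‖v c - v c'‖ ^ 2 ≤ Real.exp (-(455 / 1000) * n * L) ^ 2 := by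
      rw [← Real.exp_nat_mul]
      calc ‖v c - v c'‖ ^ 2 ≤ 2 ^ (n + 5) * (A ^ n) ^ 2 / H ^ (n - 1) := hsq
        _ ≤ Real.exp ((n + 5 : ℕ) * (L / 100)) * Real.exp (2 * n * (L / 50)) /
              Real.exp ((n - 1 : ℕ) * L) := by
            rw [hexpH]; gcongr
        _ = Real.exp ((n + 5 : ℕ) * (L / 100) + 2 * n * (L / 50) - (n - 1 : ℕ) * L) := by
            rw [Real.exp_sub, Real.exp_add]
        _ ≤ Real.exp ((2 : ℕ) * (-(455 / 1000) * n * L)) := by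
            apply Real.exp_le_exp.2
            have hn' : (50 : ℝ) ≤ n := by exact_mod_cast hn
            have hcast : ((n - 1 : ℕ) : ℝ) = n - 1 := by
              rw [Nat.cast_sub (by omega)]; simp
            rw [hcast]
            push_cast
            linarith [mul_nonneg hL0.le (show (0 : ℝ) ≤ 4 * (n : ℝ) - 105 by linarith)]
    exact (pow_le_pow_iff_left₀ (norm_nonneg _) (Real.exp_pos _).le two_ne_zero).1 hsq'

end Literature.NumberTheory.DiophantineApproximation
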